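import Summits.AtomisticToContinuum.FouriersLaw.Theses.OddSectorIrreversibility
import Summits.AtomisticToContinuum.FouriersLaw.Theorems.ClosedConeSensitivity.Negative.ZeroFrictionDictionary

/-!
# Sketch — crux idea `supersonic-hot-chain-ldp` on `ClosedConeSensitivity` (E3), round 2, ideator 5

Definitions only (no theorems, no `sorry`). First-passage percolation of the damage front in the
space-time energy field of the CLOSED chain:

* `ColdStretchDyson` — FIRST LEMMA (deterministic, banded Dyson/product-integral bound for the exact secant
  difference system on a K-cold stretch of the closed flow `detFlow`, in the rescaled norm |δq| + |δp|/M,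
  M ≍ 1 + K^{1/4}): a cold stretch of length `L` is crossed no faster than the clock speed 3e·M.
* `SupersonicHotChainBound` (SHC) — residual 1, single copy: product bound for K-hot (block, window)
  events along SUPERSONIC space-time chains (= carrier range law in packet-free form).
* `ReceiverChargeTail` (RLT) — residual 2, single copy: tail of the `charge' of one persistent CHAOTIC hot
  spot (hot window persisting for `τ` with tangent gain `≥ e^{Λτ}`), with the Gibbs factor `e^{-E/2T}` kept.
* statics/kinematics: `GibbsLocalTail`, `ClosedFlowLiouville`; the consensus successor target
  `ResampledKickCone` (copied verbatim from ideator 3's sketch, Cruxes/…/SketchIdeator3.lean) and the line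
  shape `LinePerc`.
-/

noncomputable section

open MeasureTheory Filter Set
open scoped BigOperators NNReal

namespace Summit.AtomisticToContinuum.FouriersLaw.Cruxes.ClosedConeSensitivity.Ideator5

open Literature.MathematicalPhysics.KineticTheory.HeatConduction
open Summit.AtomisticToContinuum.FouriersLaw.Theses.OddSectorIrreversibility
open Summit.AtomisticToContinuum.FouriersLaw.Theorems.ClosedConeSensitivity.Negative.ZeroFrictionDictionary

section Objects
variable (ω₂ lam β : ℝ)

/-- Site energy of the pinned chain, bond energies split evenly between the two ends:
`e_k = p_k²/2 + U(q_k) + ½V(q_{k+1}−q_k) + ½V(q_k−q_{k−1})`. -/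
def siteEnergy {N : ℕ} (x : PhaseSpace N) (k : Fin N) : ℝ :=
  x.2 k ^ 2 / 2 + (ω₂ * x.1 k ^ 2 / 2 + lam * x.1 k ^ 4 / 4) +
    (1 / 2) * ∑ j : Fin N, (if j.val = k.val + 1 ∨ k.val = j.val + 1 then
      ((x.1 j - x.1 k) ^ 2 / 2 + β * (x.1 j - x.1 k) ^ 4 / 4) else 0)

/-- Site energy along the CLOSED flow `Φ_t = detFlow` (γ = 0 kernels are Dirac masses at `detFlow`,
`ZeroFrictionDictionary.transitionKernel_zero_friction`). -/
def flowSiteEnergy (N : ℕ) (t : ℝ) (k : Fin N) (x : PhaseSpace N) : ℝ :=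
  siteEnergy ω₂ lam β (detFlow ω₂ lam β N t x) k

/-- Energy of the 3-site window around `k`, along the closed flow. -/
def flowWindowEnergy (N : ℕ) (t : ℝ) (k : Fin N) (x : PhaseSpace N) : ℝ :=
  ∑ j : Fin N, (if j.val + 1 = k.val ∨ j.val = k.val ∨ j.val = k.val + 1 then
    flowSiteEnergy ω₂ lam β N t j x else 0)

/-- Flat local difference energy of two phase points at site `k`: `(q_k − q'_k)² + (p_k − p'_k)²`. -/
def diffEnergy {N : ℕ} (y y' : PhaseSpace N) (k : Fin N) : ℝ :=
  (y.1 k - y'.1 k) ^ 2 + (y.2 k - y'.2 k) ^ 2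

/-- Squared tangent gain of the momentum direction at site `k` over time `τ` along the closed flow:
`Σ_i (∂_{p_k}(q_i∘Φ_τ))² + (∂_{p_k}(p_i∘Φ_τ))²` (the flow of a polynomial field is smooth; `partialP` is
the tree's partial derivative). Used only to say "this hot spot is a CHAOTIC amplifier at rate ≥ Λ". -/
def tangentGainSq (N : ℕ) (k : Fin N) (τ : ℝ) (x : PhaseSpace N) : ℝ :=
  ∑ i : Fin N, (partialP k (fun y => (detFlow ω₂ lam β N τ y).1 i) x ^ 2 +
    partialP k (fun y => (detFlow ω₂ lam β N τ y).2 i) x ^ 2)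

end Objects

/-- Rescaled flat local difference norm at site `k`: `|q_k − q'_k| + |p_k − p'_k| / M`. With `M²` an upper
bound for the secant stiffnesses on a cold stretch, `d/dt` of this norm is `≤ M ·` (itself + neighbours): the
growth AND hopping rate is the local FREQUENCY `M ≍ 1 + K^{1/4}` (the kinematic clock), not the `√K` pumping
rate of the stiffness-weighted energies used by the round-1 gauge cards. -/
def diffNorm {N : ℕ} (M : ℝ) (y y' : PhaseSpace N) (k : Fin N) : ℝ :=
  |y.1 k - y'.1 k| + |y.2 k - y'.2 k| / M

/-- **FIRST LEMMA (`ColdStretchDyson`, deterministic, size M).** For the closed pinned chain and ANY two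
initial data `x, x'`: if on `[t₀, t₁]` every site `k₀−1 … k₀+L+1` has site energy `≤ K` along BOTH
trajectories, then with `M := C(1 + K^{1/4})` (so that the secant stiffnesses `ā = ∫₀¹U''`, `b̄ = ∫₀¹V''`
on the stretch are `≤ M²`: `q² ≤ √(4K/lam)`, `r² ≤ √(8K/β)`) and `u := 3M(t − t₀)`, every stretch site `k`
obeys the banded-propagator (Dyson / product-integral) bound in the rescaled norm `n_j = |δq_j| + |δp_j|/M`:
`n_k(t) ≤ e^{u} · ( Σ_{j=k₀}^{k₀+L} u^{|k−j|}/|k−j|! · n_j(t₀) + Σ_{j ∈ {k₀−1, k₀+L+1}} u^{|k−j|}/|k−j|! · sup_{s∈[t₀,t]} n_j(s) )`.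
Proof: the difference of two solutions solves the EXACT linear system with the secant stiffnesses (sound,
re-derived by all three round-1 triagers); restrict it to the stretch with the two outside neighbours as
sources (variation of constants); the stretch generator in the variables `(δq, δp/M)` is tridiagonal with
operator norm `≤ 3M`; expand the time-ordered exponential (`|(𝒯e^{∫A})_{kj}| ≤ e^{u} u^{|k−j|}/|k−j|!` for a
banded family with `‖A(s)‖ ≤ 3M`, the estimate Disproof §7 quotes for the harmonic member). It is
Buttà–Marchioro's lattice iteration (tree: `BMLightCone.lattice_iteration_far`, PROVED) localised to a stretch
and written for FINITE differences. Consequences used by the line: (i) a K-cold stretch of length `L` is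
crossed no sooner than `L/(3eM) − O(log(threshold ratio))/M` after the influx reaches its near end —
crossing speed `v_K := 3e·C(1+K^{1/4})`, the clock, whatever sits behind or ahead (sub-K chaos, warm blobs,
sub-K receivers are inside `M`); (ii) with the single global threshold `E_* = 2T(m+3)log(2+d)` of the
stationary-exceedance card this ALREADY improves the provable floor from window `d/√log d` to
`d/(log d)^{1/4}` (and its partial to `D_N = O((log N)^{1/8})`) — the `√E_*` there was a gauge artefact. -/
def ColdStretchDyson : Prop :=
  ∀ ω₂ lam β : ℝ, 0 < ω₂ → 0 < lam → 0 < β → ∃ C : ℝ, 0 < C ∧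
    ∀ (N : ℕ) (x x' : PhaseSpace N) (k₀ L : ℕ) (K t₀ t₁ : ℝ), 0 ≤ K → 0 ≤ t₀ → t₀ ≤ t₁ →
      (∀ s ∈ Set.Icc t₀ t₁, ∀ j : Fin N, k₀ ≤ j.val + 1 → j.val ≤ k₀ + L + 1 →
          flowSiteEnergy ω₂ lam β N s j x ≤ K ∧ flowSiteEnergy ω₂ lam β N s j x' ≤ K) →
      ∀ t ∈ Set.Icc t₀ t₁, ∀ k : Fin N, k₀ ≤ k.val → k.val ≤ k₀ + L →
        let M : ℝ := C * (1 + K ^ (1 / 4 : ℝ))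
        let u : ℝ := 3 * M * (t - t₀)
        let Φ : ℝ → PhaseSpace N → PhaseSpace N := fun s y => detFlow ω₂ lam β N s y
        let n : ℝ → Fin N → ℝ := fun s j => diffNorm M (Φ s x) (Φ s x') j
        let G : Fin N → ℝ := fun j =>
          u ^ (Int.natAbs ((k.val : ℤ) - j.val)) / (Nat.factorial (Int.natAbs ((k.val : ℤ) - j.val)) : ℝ)
        n t k ≤ Real.exp u *
          ((∑ j : Fin N, (if k₀ ≤ j.val ∧ j.val ≤ k₀ + L then G j * n t₀ j else 0)) +
            ∑ j : Fin N, (if j.val + 1 = k₀ ∨ j.val = k₀ + L + 1 then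
              G j * (⨆ s ∈ Set.Icc t₀ t, n s j) else 0))

/-- **Residual 1 (`SupersonicHotChainBound`, SHC) — single copy, equilibrium, closed chain.**
For every hot level `K` and speed `v` there are a block length `ℓ` and constants such that, for every
SUPERSONIC space-time chain of `n` disjoint `ℓ`-blocks (`k_{j'} ≥ k_j + ℓ`, `t_{j'} ≥ t_j`,
`k_{j'} − k_j ≥ v (t_{j'} − t_j)` for `j < j'`), the Gibbs probability that EVERY block carries a site of
energy `≥ K` at some time of its window `[t_j, t_j + w]` is at most `C · p^n · Z` with the nominal
single-block price `p = C₀ ℓ (1 + w)(1+K)² e^{−K/T}` (Rice/upcrossing size of one (block, window) event;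
the line uses `w = ℓ/v_K`, `v = 2 v_K`).
Product structure along supersonic chains = "no cheap supersonic hot world-tubes": a coherent carrier of
energy `K'` realises `range(K')/ℓ` consecutive events at price `e^{−K'/T}`, so SHC holds iff carrier range is
at most LINEAR in energy, `range(K') ≤ c₀K'/T`, with the block length chosen `ℓ ≥ c₀ K/T` (kit j014730
measures the range law and its tail); relays of distinct packets must draw on distinct energy. Infinite-range
supersonic carriers would make the conductivity infinite (ballistic channel), so the weak form of SHC is
NECESSARY for `FouriersLaw`; `E2`-type transport variances cannot supply it. -/
def SupersonicHotChainBound : Prop :=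
  ∀ ω₂ lam β γ : ℝ, 0 < ω₂ → 0 < lam → 0 < β → 0 < γ → ∀ T : ℝ, 0 < T → ∃ C₀ : ℝ,
    ∀ K v w : ℝ, 0 < K → 0 < v → 0 < w → ∃ ℓ : ℕ, 1 ≤ ℓ ∧ ∃ C : ℝ,
      ∀ (N n : ℕ) (k : Fin n → ℕ) (t : Fin n → ℝ),
        (∀ j, 0 ≤ t j) →
        (∀ i j : Fin n, i < j → k i + ℓ ≤ k j ∧ t i ≤ t j ∧ v * (t j - t i) ≤ (k j : ℝ) - k i) →
        let P := pinnedChain ω₂ lam β γ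
        let μT : Measure (PhaseSpace N) :=
          volume.withDensity (fun x : PhaseSpace N => ENNReal.ofReal (Real.exp (-(P.hamiltonian N x) / T)))
        μT {x | ∀ j : Fin n, ∃ s : ℝ, t j ≤ s ∧ s ≤ t j + w ∧
              ∃ i : Fin N, k j ≤ i.val ∧ i.val < k j + ℓ ∧ K ≤ flowSiteEnergy ω₂ lam β N s i x}
          ≤ ENNReal.ofReal (C * (C₀ * ℓ * (1 + w) * (1 + K) ^ 2 * Real.exp (-K / T)) ^ n *
              ∫ x, Real.exp (-(P.hamiltonian N x) / T) ∂volume)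

/-- **Residual 2 (`ReceiverChargeTail`, RLT) — single copy.** The only hot objects a localised
first-passage proof cannot absorb are CHAOTIC hot spots AHEAD of the front that amplify the (exponentially
small) precursor before the front arrives ("receivers", ideator 3's B4). Their power is their `charge'
rate × lifetime. RLT: above a rate `Λ₀` and an energy `E₀`, a 3-site window that is hot at level `E`,
stays above `E/2` for time `τ` AND amplifies the momentum direction by `≥ e^{Λτ}` has Gibbs probability
`≤ C e^{−E/(2T)} (1+τ)^{−m} Z`, uniformly in `N`, the site and `E ≥ E₀`. The kept factor `e^{−E/2T}` is what
lets the receiver envelope `sup_E ν(E) S_E(c d/λ(E))` be summed; it is exactly where the statement can FAIL: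
Arrhenius lifetimes `τ̄(E) ≍ e^{αE/T}` of thermal chaotic breathers give a cone tail `d^{−1/α}` and violate
RLT as soon as `α > 1/(2m)` (kit j014874 measures `α` at ρ = β/lam ∈ {0.1, 1}). Elliptic (regular) breathers
are excluded by the gain condition (polynomial gain), sticky near-island episodes likewise (small rate). -/
def ReceiverChargeTail : Prop :=
  ∀ ω₂ lam β γ : ℝ, 0 < ω₂ → 0 < lam → 0 < β → 0 < γ → ∀ T : ℝ, 0 < T → ∃ Λ₀ : ℝ, 0 < Λ₀ ∧
    ∀ Λ : ℝ, Λ₀ ≤ Λ → ∀ m : ℝ, 0 < m → ∃ E₀ C : ℝ, ∀ E : ℝ, E₀ ≤ E →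
      ∀ (N : ℕ) (k : Fin N) (τ : ℝ), 0 ≤ τ →
        let P := pinnedChain ω₂ lam β γ
        let μT : Measure (PhaseSpace N) :=
          volume.withDensity (fun x : PhaseSpace N => ENNReal.ofReal (Real.exp (-(P.hamiltonian N x) / T)))
        μT {x | E ≤ flowWindowEnergy ω₂ lam β N 0 k x ∧
              (∀ s ∈ Set.Icc (0 : ℝ) τ, E / 2 ≤ flowWindowEnergy ω₂ lam β N s k x) ∧
              Real.exp (Λ * τ) ≤ Real.sqrt (tangentGainSq ω₂ lam β N k τ x)}
          ≤ ENNReal.ofReal (C * Real.exp (-E / (2 * T)) * (1 + τ) ^ (-m) *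
              ∫ x, Real.exp (-(P.hamiltonian N x) / T) ∂volume)

/-- Static input (`GibbsLocalTail`, M–L, fixed-time 1-D transfer-operator statistics): N-uniform local
Gibbs tails including the END sites, `μ_T{e_k ≥ E} ≤ C(1+E)^c e^{−E/T} Z`. -/
def GibbsLocalTail : Prop :=
  ∀ ω₂ lam β γ : ℝ, 0 < ω₂ → 0 < lam → 0 < β → 0 < γ → ∀ T : ℝ, 0 < T → ∃ C c : ℝ,
    ∀ (N : ℕ) (k : Fin N) (E : ℝ), 0 ≤ E →
      let P := pinnedChain ω₂ lam β γ
      let μT : Measure (PhaseSpace N) :=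
        volume.withDensity (fun x : PhaseSpace N => ENNReal.ofReal (Real.exp (-(P.hamiltonian N x) / T)))
      μT {x | E ≤ siteEnergy ω₂ lam β x k}
        ≤ ENNReal.ofReal (C * (1 + E) ^ c * Real.exp (-E / T) * ∫ x, Real.exp (-(P.hamiltonian N x) / T) ∂volume)

/-- Kinematic input (`ClosedFlowLiouville`, M): the unnormalised Gibbs weight is invariant under the closed
flow (energy conservation `hamiltonian_detFlow` PROVED + volume preservation of a Hamiltonian flow,
pattern `ConfinedFlowJacobian.map_flow_volume`). -/
def ClosedFlowLiouville : Prop :=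
  ∀ ω₂ lam β γ : ℝ, 0 < ω₂ → 0 < lam → 0 < β → 0 < γ → ∀ T : ℝ, 0 < T → ∀ (N : ℕ) (t : ℝ), 0 ≤ t →
    let P := pinnedChain ω₂ lam β γ
    let μT : Measure (PhaseSpace N) :=
      volume.withDensity (fun x : PhaseSpace N => ENNReal.ofReal (Real.exp (-(P.hamiltonian N x) / T)))
    MeasurePreserving (detFlow ω₂ lam β N t) μT μT

section Target
variable {N : ℕ}

/-- Mean-square resampled-kick difference `½ ∫ (g(q,p[b↦p']) − g(q,p))² dN(0,T)(p')` (verbatim from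
ideator 3's `SketchIdeator3.resampleVar`). -/
def resampleVar (T : ℝ≥0) (b : Fin N) (g : PhaseSpace N → ℝ) (x : PhaseSpace N) : ℝ :=
  (1 / 2) * ∫ p', (g (x.1, Function.update x.2 b p') - g x) ^ 2 ∂(ProbabilityTheory.gaussianReal 0 T)

end Target

/-- The consensus successor of E3 (`ResampledKickCone`, ideator 3 / TRIAGE r1 ×3; copied verbatim so that
the line's target is literally the restatement the panel recommends): mean-square locality of the closed
flow under a THERMAL RESAMPLING of the contact momentum, linear window `t ≤ a d`, polynomial tail. -/
def ResampledKickCone : Prop :=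
  ∀ ω₂ lam β γ : ℝ, 0 < ω₂ → 0 < lam → 0 < β → 0 < γ → ∀ T : ℝ≥0, 0 < (T : ℝ) → ∀ m : ℝ, 0 < m →
    ∃ a C : ℝ, 0 < a ∧ ∀ (N : ℕ) (i b : Fin N) (t : ℝ), (b.val = 0 ∨ b.val = N - 1) → 0 ≤ t →
      let P := pinnedChain ω₂ lam β γ
      let P₀ := pinnedChain ω₂ lam β 0
      let μT : Measure (PhaseSpace N) :=
        volume.withDensity (fun x : PhaseSpace N => ENNReal.ofReal (Real.exp (-(P.hamiltonian N x) / T)))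
      let d : ℕ := (if b.val = 0 then i.val else N - 2 - i.val)
      let jt : PhaseSpace N → ℝ := fun x => ∫ y, P.bondCurrent N i y ∂(P₀.transitionKernel N T T t.toNNReal x)
      t ≤ a * (d : ℝ) →
        ∫ x, resampleVar T b jt x ∂μT ≤ C * (1 + ((d : ℝ) - t / a)) ^ (-m) * ∫ x, Real.exp (-(P.hamiltonian N x) / T) ∂volume

/-- **Shape of the line (`LinePerc`)** — first-passage percolation of the damage front: the deterministic
cold-stretch delay + Liouville + static tails + (Rice single-time pricing, ideator 3's
`StationaryUpcrossingBound`, reused) + path counting over supersonic block chains reduce the linear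
resampled-kick cone to the two equilibrium large-deviation inputs SHC and RLT. The composition itself is
the crux-plan seat's theorem; the two residuals are the bets. -/
def LinePerc : Prop :=
  ColdStretchDyson → ClosedFlowLiouville → GibbsLocalTail → SupersonicHotChainBound → ReceiverChargeTail →
    ResampledKickCone

end Summit.AtomisticToContinuum.FouriersLaw.Cruxes.ClosedConeSensitivity.Ideator5

end
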